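import Mathlib.Algebra.Group.Subgroup.Pointwise
import Mathlib.GroupTheory.GroupAction.ConjAct
import Mathlib.GroupTheory.QuotientGroup.Defs
import Literature.IUT.HodgeArakelov.ThetaEvaluationSubgraphs
import Literature.IUT.HodgeArakelov.ThetaEvaluationSetting

/-!
# [IUTchII] Remarks 2.5.2 (i)–(iv), 2.6.1 (i)–(ii): the group-theoretic and combinatorial clauses —
# PROOF companion (0 definitions)

S. Mochizuki, *Inter-universal Teichmüller theory II*, §2 "Galois-theoretic theta evaluation", kurims
manuscript (Dec-2020 render `IUTchII-kurims-url-5036b4059555`): Remark 2.5.2 (i) p. 73 l. 55 – p. 74 l. 28,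
(ii) p. 74 l. 29–62, (iii) p. 74 l. 63 – p. 75 l. 40, (iv) p. 75 l. 41–58 (Fig. 2.1); Remark 2.6.1 (i) p. 76
l. 85 – p. 77 l. 18, (ii) p. 77 l. 19–42 [cite: Mochizuki2012, Rmk 2.5.2 p.73]. Claim key DISPUTED (D-0012):
nothing of the disputed theory is asserted; every theorem below is an elementary statement of group theory
/ combinatorics / the typed theta-value orbits, PROVED, rendering a printed clause of these remarks whose
slots in the landed typer file `ThetaEvaluationSubgraphs` (`Remark251252Statements`,
`Remark261262Statements`; abc-iut-L6-t2, p404618) are SLOT-ONLY.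

What is printed and what is proved here.
* Rmk 2.5.2 (i): "one may think of the various inclusion morphisms `I^{γ₁}_t ↪ Π^{γ₂}_{v¨▶}` as a sort of
  morphism between quotients `(Δ̂^±_v ↷ {I^{γ₁}_t}) / Δ̂^±_v → (Δ̂^±_v ↷ {Π^{γ₂}_{v¨▶}}) / Δ̂^±_v`" — PROVED as the
  equivariance of the inclusion relation between conjugates under simultaneous conjugation
  (`Rmk252i_inclusion_conj_invariant`); "unlike the situation discussed in Remark 1.12.4, in which the
  subgroup `Π_Ÿ(Π) ⊆ Π` is normal, the subgroups `Π_{v▶}, Π_{v¨▶} ⊆ Π̂^±_v` are far from being normal!" —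
  PROVED in the form: in the normal case the relation does not see the conjugating element
  (`Rmk252i_inclusion_of_normal`), and a commensurably terminal proper subgroup — `Π_{v▶} ⊆ Π_v` is
  commensurably terminal by Remark 2.2.1 (`Rmk221_commTerminal`, [IUTchI] Cor. 2.3 (iv)) — is NOT
  normal (`not_normal_of_isCommensurablyTerminal`, `Rmk252i_tri_not_normal`).
* Rmk 2.5.2 (iii): "neither of the natural surjections `Π̂^±_v ↠ G_v`, `Π^{⊚±} ↠ G_K` admits a section that
  simultaneously normalizes the subgroups `I_t` … it follows that any `G_v`-conjugacy indeterminacy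
  necessarily results in a `Δ̂^±_v`-conjugacy indeterminacy acting on the various `I_t`" — PROVED as the
  Frattini-type transfer: when the `Π`-conjugacy class of `I_t` is already a `Δ`-conjugacy class (a
  `G`-rational label), an element NOT normalizing `I_t` conjugates it to a DIFFERENT `Δ`-conjugate
  (`Rmk252iii_delta_conj_of_not_mem_normalizer`), with the logical form of the no-section premiss
  (`Rmk252iii_exists_not_normalizing`); "since the natural surjection `Δ̂^cor_v ↠ Δ̂^cor_v/Δ̂^±_v` does
  not admit a splitting, … the `Δ̂^±_v`-outer action … induces independent `Δ̂^±_v`-conjugacy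
  indeterminacies on the subgroups `I_t`" — PROVED as: two lifts of one element of the quotient transport
  a subgroup to results that differ by conjugation by the kernel (`Rmk252iii_lift_indeterminacy`).
  The cited inputs themselves ([AbsSect] Thm. 1.3 (ii), [pGC] Thm. C, [NSW] Cor. 12.1.3) are NOT in the
  tree and are not asserted.
* Rmk 2.5.2 (iv), Fig. 2.1: "since the translation actions on the upper and lower lines are not
  synchronized …, there is no way to separate … the inclusion of a «∘» into a «•→•» as the left-hand «•»
  from the inclusion of the same «∘» into some «•→•» as the right-hand «•»" — PROVED for the two lines
  `ℤ` (vertices `∘ = i`, edges `•→• = (j, j+1)`): no relation invariant under INDEPENDENT translations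
  separates left inclusions `i = j` from right inclusions `i = j + 1` (`Rmk252iv_fig21_inseparable`),
  whereas under the SYNCHRONIZED diagonal action the left-inclusion relation itself is invariant and
  separates (`Rmk252iv_fig21_synchronized_separates`).
* Rmk 2.6.1 (i)–(ii), "conjugate synchronization": the theta values "for various `|t| ∈ |F_l|` are all
  computed relative to the single copy … of the Galois group … and the single cyclotome"; "a single
  cyclotome … that acts simultaneously on the `N`-th roots of all of the theta values" — over the typed
  orbits `thetaValueAt` (one module `H`, one `μ_{2l} = rootsOfUnity twoL H` for every label): the single
  `μ_{2l}` acts on every label's orbit (`Rmk261i_single_cyclotome_acts`), any two values at one label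
  differ by an element of that single `μ_{2l}` (`Rmk261i_ratio_pow_twoL`), and the whole collection of
  theta values is stable under it (`Rmk261ii_collection_stable`).
Typed by abc-iut-L6-t12 (gen 5) as interim/INDEX work on the L6-lead offer «IUTchII-RMK25-26-283-COVERAGE»
part A (STATUS 2026-08-26T12:09:51Z split with abc-iut-w4-d018; holder of record per the lead).
-/

namespace Literature.IUT.HodgeArakelov

open scoped Pointwise

universe u

/-! ### 1. Remark 2.5.2 (i): inclusions of conjugates as "a sort of morphism between quotients" -/

section Rmk252i

variable {G : Type u} [Group G]

/-- **IUTchII:Rmk2.5.2(i)** (kurims p. 73 l. 73 – p. 74 l. 18): the inclusion relation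
`I^{γ₁} ⊆ P^{γ₂}` between conjugates of two subgroups (`I = I_t` or `D_{t,μ_-}`, `P = Π_{v¨▶}`) is invariant
under simultaneous left multiplication of `(γ₁, γ₂)` by one element — i.e. it descends to "a sort of
morphism between quotients" `(Δ̂^±_v ↷ {I^{γ₁}_t})/Δ̂^±_v → (Δ̂^±_v ↷ {Π^{γ₂}_{v¨▶}})/Δ̂^±_v` by the diagonal
conjugation action. PROVED (pure group theory). [cite: Mochizuki2012, Rmk 2.5.2 (i) p.73] -/
theorem Rmk252i_inclusion_conj_invariant (I P : Subgroup G) (g γ₁ γ₂ : G) :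
    ConjAct.toConjAct (g * γ₁) • I ≤ ConjAct.toConjAct (g * γ₂) • P ↔
      ConjAct.toConjAct γ₁ • I ≤ ConjAct.toConjAct γ₂ • P := by
  rw [ConjAct.toConjAct_mul, ConjAct.toConjAct_mul, mul_smul, mul_smul,
    Subgroup.pointwise_smul_le_pointwise_smul_iff]

/-- **IUTchII:Rmk2.5.2(i)** (kurims p. 74 l. 25–28), the contrast case: "in the situation discussed in
Remark 1.12.4, in which the subgroup `Π_Ÿ(Π) ⊆ Π` is normal", the target of the inclusion does not depend
on the conjugating element `γ₂` at all. PROVED. [cite: Mochizuki2012, Rmk 2.5.2 (i) p.74] -/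
theorem Rmk252i_inclusion_of_normal (I P : Subgroup G) (hP : P.Normal) (γ₁ γ₂ : G) :
    ConjAct.toConjAct γ₁ • I ≤ ConjAct.toConjAct γ₂ • P ↔ ConjAct.toConjAct γ₁ • I ≤ P := by
  rw [hP.conjAct]

/-- **IUTchII:Rmk2.5.2(i)** with **Rmk 2.2.1** (kurims p. 74 l. 27–28; p. 67): a commensurably terminal
subgroup ([AbsAnab] Def. 0.1 (iii), the tree's `IsCommensurablyTerminal`) which is proper is NOT normal —
"the subgroups `Π_{v▶}, Π_{v¨▶}` … are far from being normal!". PROVED: a normal subgroup is fixed by every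
conjugation, so by `Rmk221_inner` every element lies in it. [cite: Mochizuki2012, Rmk 2.5.2 (i) p.74] -/
theorem not_normal_of_isCommensurablyTerminal (H : Subgroup G)
    (hH : Literature.AnabelianGeometry.AbsoluteAnabelian.IsCommensurablyTerminal H) (hne : H ≠ ⊤) :
    ¬ H.Normal := by
  intro hN
  apply hne
  rw [eq_top_iff]
  intro g _
  exact Rmk221_inner H hH g (hN.conjAct _)

/-- **IUTchII:Rmk2.5.2(i)** at the Prop. 2.2 data (kurims p. 74 l. 27–28): granted the commensurable
terminality of `Π_{v▶} ⊆ Π_v` of Remark 2.2.1 (`Rmk221_commTerminal Dec`, [IUTchI] Cor. 2.3 (iv)) and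
`Π_{v▶} ≠ Π_v`, the decomposition group `Π_{v▶}` is not normal in `Π_v` (a fortiori not in `Π̂^±_v ⊇ Π_v`).
PROVED. [cite: Mochizuki2012, Rmk 2.5.2 (i) p.74] -/
theorem Rmk252i_tri_not_normal {S : BadPlaceSetting.{u}} {P : TopGroup.{u}} {T : TemperedCoverings S P}
    {D : EtaleThetaData S.toThetaSetting P} (Dec : SubgraphDecomposition S T D)
    (hct : Rmk221_commTerminal Dec) (hne : Dec.Ptri ≠ ⊤) : ¬ Dec.Ptri.Normal :=
  not_normal_of_isCommensurablyTerminal Dec.Ptri hct hne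

end Rmk252i

/-! ### 2. Remark 2.5.2 (iii): conjugacy indeterminacies transfer from `G_v` to `Δ̂^±_v` -/

section Rmk252iii

variable {G : Type u} [Group G]

/-- **IUTchII:Rmk2.5.2(iii)** (kurims p. 74 l. 73 – p. 75 l. 15), the logical form of the premiss
"neither of the natural surjections `Π̂^±_v ↠ G_v`, `Π^{⊚±} ↠ G_K` admits a section that simultaneously
normalizes the subgroups `I_t`, as `t` ranges over the elements of `LabCusp^±`": EVERY section then fails
to normalize some `I_t` at some element. PROVED (classical logic over the typed shape; the premiss itself —
[AbsSect] Thm. 1.3 (ii), [pGC] Thm. C — is NOT asserted). [cite: Mochizuki2012, Rmk 2.5.2 (iii) p.74] -/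
theorem Rmk252iii_exists_not_normalizing {Q : Type u} [Group Q] {Lab : Type u} (π : G →* Q)
    (I : Lab → Subgroup G)
    (hno : ¬ ∃ s : Q →* G, (∀ q, π (s q) = q) ∧ ∀ t, s.range ≤ Subgroup.normalizer (I t : Set G))
    (s : Q →* G) (hs : ∀ q, π (s q) = q) :
    ∃ t, ∃ q, s q ∉ Subgroup.normalizer (I t : Set G) := by
  by_contra h
  push Not at h
  exact hno ⟨s, hs, fun t x ⟨q, hq⟩ => hq ▸ h t q⟩

/-- **IUTchII:Rmk2.5.2(iii)** (kurims p. 75 l. 9–15) "any `G_v`-conjugacy indeterminacy necessarily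
results in a `Δ̂^±_v`-conjugacy indeterminacy acting on the various `I_t`", PROVED as the Frattini-type
transfer: if the `Π`-conjugacy class of `I` is a `Δ`-conjugacy class (every `Π`-conjugate of `I` is a
`Δ`-conjugate — the label of `I` is `G`-rational), then an element `g` that does NOT normalize `I`
conjugates `I` to `δ I δ⁻¹` for some `δ ∈ Δ` which does not normalize `I` either, so that `δ I δ⁻¹ ≠ I`:
the indeterminacy is a genuine `Δ`-conjugacy indeterminacy. [cite: Mochizuki2012, Rmk 2.5.2 (iii) p.75] -/
theorem Rmk252iii_delta_conj_of_not_mem_normalizer (Δ I : Subgroup G)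
    (hrat : ∀ g : G, ∃ δ ∈ Δ, ConjAct.toConjAct g • I = ConjAct.toConjAct δ • I)
    (g : G) (hg : g ∉ Subgroup.normalizer (I : Set G)) :
    ∃ δ ∈ Δ, ConjAct.toConjAct g • I = ConjAct.toConjAct δ • I ∧
      δ ∉ Subgroup.normalizer (I : Set G) ∧ ConjAct.toConjAct δ • I ≠ I := by
  obtain ⟨δ, hδ, hgδ⟩ := hrat g
  have hδn : δ ∉ Subgroup.normalizer (I : Set G) := by
    intro hδn
    apply hg
    rw [← Subgroup.conjAct_pointwise_smul_iff, hgδ]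
    exact Subgroup.conjAct_pointwise_smul_eq_self hδn
  exact ⟨δ, hδ, hgδ, hδn, fun h => hδn (Subgroup.conjAct_pointwise_smul_iff.mp h)⟩

/-- **IUTchII:Rmk2.5.2(iii)** (kurims p. 75 l. 16–30) "since the natural surjection
`Δ̂^cor_v ↠ Δ̂^cor_v/Δ̂^±_v` does not admit a splitting, … the `Δ̂^±_v`-outer action of `Δ̂^cor_v/Δ̂^±_v ≅ 𝔽_l^{⋊±}`
… induces … `Δ̂^±_v`-conjugacy indeterminacies on the subgroups `I_t`", PROVED as: two lifts `c, c'` to `C`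
of one element of `C/N` transport a subgroup `I` to conjugates that differ by conjugation by an element
of the kernel `N` — transport along an OUTER action is defined only up to `N`-conjugacy (for each
subgroup separately; the independence over distinct `t` is Fig. 2.1, §3). [cite: Mochizuki2012, Rmk 2.5.2 (iii) p.75] -/
theorem Rmk252iii_lift_indeterminacy {C : Type u} [Group C] (N : Subgroup C) [N.Normal] (c c' : C)
    (h : (c : C ⧸ N) = c') (I : Subgroup C) :
    ∃ n ∈ N, ConjAct.toConjAct c' • I = ConjAct.toConjAct n • (ConjAct.toConjAct c • I) := by
  refine ⟨c' * c⁻¹, ?_, ?_⟩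
  · have h1 : c⁻¹ * c' ∈ N := QuotientGroup.eq.mp h
    have h2 := Subgroup.Normal.conj_mem inferInstance _ h1 c
    simpa [mul_assoc] using h2
  · rw [← mul_smul, ← ConjAct.toConjAct_mul, inv_mul_cancel_right]

end Rmk252iii

/-! ### 3. Remark 2.5.2 (iv), Fig. 2.1: independent versus synchronized translations -/

section Rmk252iv

/-- **IUTchII:Rmk2.5.2(iv)**, Fig. 2.1 (kurims p. 75 l. 41–58): model the upper line of "∘"'s by `i : ℤ`
and the lower line of "•→•"'s by `j : ℤ` (the edge from `•_j` to `•_{j+1}`), "equipped with independent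
actions by groups of horizontal translations [i.e., each of which is isomorphic to `ℤ`]". Then "there
is no way to separate — i.e., in a fashion that is compatible with the indeterminacy arising from both
translation actions — the inclusion of a «∘» into a «•→•» as the left-hand «•» [`i = j`] from the
inclusion of the same «∘» into some «•→•» as the right-hand «•» [`i = j + 1`]": every relation invariant
under the two INDEPENDENT translation actions that holds for all left inclusions holds for all right
inclusions, and conversely. PROVED. [cite: Mochizuki2012, Rmk 2.5.2 (iv) p.75] -/
theorem Rmk252iv_fig21_inseparable (R : ℤ → ℤ → Prop)
    (hR : ∀ a b i j, R i j ↔ R (i + a) (j + b)) :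
    ((∀ j, R j j) ↔ ∀ j, R (j + 1) j) ∧
      ∀ i j i' j', R i j → R i' j' := by
  have key : ∀ i j i' j', R i j → R i' j' := by
    intro i j i' j' h
    have := (hR (i' - i) (j' - j) i j).mp h
    simpa using this
  exact ⟨⟨fun h j => key j j (j + 1) j (h j), fun h j => key (j + 1) j j j (h j)⟩, key⟩

/-- **IUTchII:Rmk2.5.2(iv)**, Fig. 2.1 (kurims p. 75 l. 52–54), the contrast "since the translation
actions on the upper and lower lines are not synchronized with one another": under the SYNCHRONIZED
(diagonal) translation action the left-inclusion relation `i = j` IS invariant, holds for every left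
inclusion and for NO right inclusion — so synchronization is exactly what would permit the separation.
PROVED. [cite: Mochizuki2012, Rmk 2.5.2 (iv) p.75] -/
theorem Rmk252iv_fig21_synchronized_separates :
    (∀ a i j : ℤ, (i = j ↔ i + a = j + a)) ∧ (∀ j : ℤ, j = j) ∧ ∀ j : ℤ, ¬ (j + 1 = j) := by
  refine ⟨fun a i j => ?_, fun _ => rfl, fun j h => ?_⟩
  · constructor
    · rintro rfl; rfl
    · intro h; exact add_right_cancel h
  · omega

end Rmk252iv

/-! ### 4. Remark 2.6.1 (i)–(ii): conjugate synchronization — one Galois group, one cyclotome for all labels -/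

section Rmk261

variable {H : Type u} [CommGroup H] [DecidableEq H] (twoL : ℕ) [Fintype (rootsOfUnity twoL H)]

/-- **IUTchII:Rmk2.6.1(i)** (kurims p. 77 l. 2–16) "these theta values `θ^{|t|}(Π^γ_{v¨▶})` … for various
`|t| ∈ |F_l|` are all computed relative to the single copy … of the Galois group … and the single cyclotome
… [i.e., which is independent of `|t|`!]": over the typed orbits `thetaValueAt twoL q j ⊆ H` (all labels
`j` in ONE module `H`), the single `μ_{2l} = rootsOfUnity twoL H` acts on the orbit at EVERY label.
PROVED. [cite: Mochizuki2012, Rmk 2.6.1 (i) p.77] -/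
theorem Rmk261i_single_cyclotome_acts (q : H) (j : ℕ) (ζ : rootsOfUnity twoL H) (x : H)
    (hx : x ∈ thetaValueAt twoL q j) : ((ζ : Hˣ) : H) * x ∈ thetaValueAt twoL q j := by
  rw [mem_thetaValueAt] at hx ⊢
  obtain ⟨ζ', rfl⟩ := hx
  refine ⟨ζ * ζ', ?_⟩
  simp only [Subgroup.coe_mul, Units.val_mul, mul_assoc]

/-- **IUTchII:Rmk2.6.1(i)** (kurims p. 77 l. 9–16), "conjugate synchronization" in the kernel form: any
two theta values at one label differ by an element of the SINGLE cyclotome — their ratio is killed by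
`2l`, the same `2l` for every label. PROVED. [cite: Mochizuki2012, Rmk 2.6.1 (i) p.77] -/
theorem Rmk261i_ratio_pow_twoL (q : H) (j : ℕ) (x x' : H) (hx : x ∈ thetaValueAt twoL q j)
    (hx' : x' ∈ thetaValueAt twoL q j) : (x' * x⁻¹) ^ twoL = 1 := by
  rw [mem_thetaValueAt] at hx hx'
  obtain ⟨ζ, rfl⟩ := hx
  obtain ⟨ζ', rfl⟩ := hx'
  have h1 : (((ζ' : Hˣ) : H) * q ^ (j ^ 2)) * (((ζ : Hˣ) : H) * q ^ (j ^ 2))⁻¹ =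
      ((ζ' : Hˣ) : H) * (((ζ : Hˣ) : H))⁻¹ := by
    rw [mul_inv, mul_assoc, mul_comm (((ζ : Hˣ) : H))⁻¹, ← mul_assoc (q ^ (j ^ 2)), mul_inv_cancel,
      one_mul]
  rw [h1]
  have hζ : (((ζ : Hˣ) : H)) ^ twoL = 1 := by
    have := ζ.2
    rw [mem_rootsOfUnity] at this
    have := congrArg Units.val this
    simpa using this
  have hζ' : (((ζ' : Hˣ) : H)) ^ twoL = 1 := by
    have := ζ'.2
    rw [mem_rootsOfUnity] at this
    have := congrArg Units.val this
    simpa using this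
  rw [mul_pow, inv_pow, hζ, hζ', inv_one, mul_one]

/-- **IUTchII:Rmk2.6.1(ii)** (kurims p. 77 l. 22–32) "the collection of theta values, for `|t| ∈ 𝔽_l^⋇`, be
treated as a single unified entity, whose Kummer theory may be described by considering the action of a
single Galois group … relative to a single cyclotome … that acts simultaneously on … all of the theta
values": the whole collection `⋃_j θ^j` of typed theta values is stable under the single `μ_{2l}`.
PROVED. [cite: Mochizuki2012, Rmk 2.6.1 (ii) p.77] -/
theorem Rmk261ii_collection_stable (q : H) (ζ : rootsOfUnity twoL H) (x : H)
    (hx : x ∈ ⋃ j : ℕ, (thetaValueAt twoL q j : Set H)) :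
    ((ζ : Hˣ) : H) * x ∈ ⋃ j : ℕ, (thetaValueAt twoL q j : Set H) := by
  rw [Set.mem_iUnion] at hx ⊢
  obtain ⟨j, hj⟩ := hx
  exact ⟨j, Finset.mem_coe.mpr (Rmk261i_single_cyclotome_acts twoL q j ζ x (Finset.mem_coe.mp hj))⟩

end Rmk261

end Literature.IUT.HodgeArakelov
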